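import Mathlib
import Summits.ResolutionOfSingularities.ResolutionOfSingularities.Theorems.WeightedInvariantHypersurfaceCentreAlgebraize
import Summits.ResolutionOfSingularities.ResolutionOfSingularities.Theorems.WeightedInvariantKWildHomSlotSplit
import HarnessLib

/-!
# (H3) of (K-wild-hom), step 2b: REPLACING ONE SLOT `uₗ ↦ h` with `uₗ − c·h ∈ J_{wₗ}(u[l ↦ 0])`, `c` a unit, `h ∈ J_{wₗ}(u)`, PRESERVES the
# whole weighted monomial filtration

Route `ResolutionOfSingularities/WeightedInvariant`, door crux `HypersurfaceCentreConstruction` (stmt-ResolutionOfSingularities-19897), P3 rung;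
ORDER (o50) of res-L1-w43-plan-1, kernel item (H3) (memo `plan/tools/res-type-060/o50/K-WILD-HOM.md` §2/§6), step 2b; res-type-060 (gen 10).
[OURS · L1 W4.3 · helper, counted 0] — the jets lemma `weightedMonomialIdeal_eq_of_forall_sub_mem` (…HypersurfaceCentreAlgebraize) + step 2a
(…KWildHomSlotSplit).  AI proof, weaker than expert review.

* `KWildHom.weightedMonomialIdeal_update_eq_of_unit_mul_sub_mem` — if `c` is a unit, `uₗ − c·h ∈ J_{wₗ}(u[l ↦ 0])` and `h ∈ J_{wₗ}(u)`, then
  `J_n(u[l ↦ h]) = J_n(u)` for every `n`.  With step 1 (`exists_unit_mul_sub_mem_of_span_eq`: such `h` exists among ANY generating set of `J_{wₗ}(u)`,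
  e.g. the homogeneous generators of `hJhom`) this is the slot-by-slot homogenisation of the σ-maximising flag (memo §2); remaining for (H3): the
  r.s.p./two-flag bookkeeping of the new system and the `IsSigmaMaximiser` transfer through 070's bridge.
-/

set_option linter.dupNamespace false -- mandated namespace of this single-conjunct summit

namespace Summit.ResolutionOfSingularities.ResolutionOfSingularities.Theorems

namespace KWildHom

open Literature.AlgebraicGeometry.Resolution

variable {A : Type*} [CommRing A] {m : ℕ}

/-- **SLOT REPLACEMENT PRESERVES THE WEIGHTED FILTRATION**: `c` a unit, `uₗ − c·h ∈ J_{wₗ}(u[l ↦ 0])`, `h ∈ J_{wₗ}(u)` ⇒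
`J_n(u[l ↦ h]) = J_n(u)` for all `n`. [OURS · L1 W4.3] -/
theorem weightedMonomialIdeal_update_eq_of_unit_mul_sub_mem (u : Fin m → A) (w : Fin m → ℕ) (l : Fin m) {h c : A} (_hc : IsUnit c)
    (hmem : u l - c * h ∈ weightedMonomialIdeal (Function.update u l 0) w (w l)) (hh : h ∈ weightedMonomialIdeal u w (w l)) (n : ℕ) :
    weightedMonomialIdeal (Function.update u l h) w n = weightedMonomialIdeal u w n := by
  refine weightedMonomialIdeal_eq_of_forall_sub_mem u (Function.update u l h) w (fun i => ?_) (fun i => ?_) n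
  · by_cases hi : i = l
    · subst hi
      rw [Function.update_self]
      exact Ideal.sub_mem _ hh (self_mem_weightedMonomialIdeal u w i)
    · rw [Function.update_of_ne hi, sub_self]; exact Ideal.zero_mem _
  · by_cases hi : i = l
    · subst hi
      rw [Function.update_self]
      have hsplit : u i - h = (u i - c * h) + (c - 1) * h := by ring
      rw [hsplit]
      refine Ideal.add_mem _ ?_ (Ideal.mul_mem_left _ _ ?_)
      · have hle := weightedMonomialIdeal_update_zero_le (Function.update u i h) w i (w i)
        rw [Function.update_idem] at hle
        exact hle hmem
      · have := self_mem_weightedMonomialIdeal (Function.update u i h) w i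
        rwa [Function.update_self] at this
    · rw [Function.update_of_ne hi, sub_self]; exact Ideal.zero_mem _

end KWildHom

end Summit.ResolutionOfSingularities.ResolutionOfSingularities.Theorems
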